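import Mathlib
import Literature.AlgebraicGeometry.Resolution.CobordantGame
import Summits.ResolutionOfSingularities.ResolutionOfSingularities.Theorems.WeightedInvariantLocalWeightedDropGradedSliceWildConjMove

/-!
# `WeightedInvariant.LocalWeightedDrop`: SUPPORT OF A WILD SUCCESSOR — every monomial of the renormalised successor `g ∘ Λ_q` projects
# (`y_v ↦ 1`) onto a monomial of the slice

Route `ResolutionOfSingularities/WeightedInvariant`, crux `LocalWeightedDrop` (stmt-ResolutionOfSingularities-8899).
[OURS · L1 W4.3] — res-type-099 (gen 13): ideator res-L1-w43-idea-1's ROUND-5 stub `Round5.stub_support_wildSuccessor` (Sketch-L1-idea-1 v5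
§11c-5, «(R5-supp) SUPPORT OF A WILD SUCCESSOR [stub, M; provable from p524471 `subst_wildLambdaFrob_eq` with res-type-099's Frobenius-root
tools p526968]»), PROVED with that stub's signature (`support_wildSuccessor`).  In the renormalised frame `Λ_q` (res-type-060, p524471) at a
frozen coordinate `v` = last of minimal valuation, `G := g ∘ Λ_q` satisfies `G(…, y_v^q) = (1+y_v)ᵃ · h((1+y_v)^ρ x)` with `h = g|_{y_v=0}` and
`ρ = (1, resExp w q ·)` (`subst_frobFamily_wildLambda_eq_scaleFam`); so `[x^e y_v^{qt}] G(…,y_v^q) = h_e · [y_v^t…]` and `[x^e y_v^0] = h_e`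
(`coeff_pureLast_mul_subst_scaleFam`, p528590), and the exponents of `G` are read off through `frobRoot`'s coefficient dictionary
(`coeff_linExp_subst_frobFamily`, p526968): **`coeff d G ≠ 0 → coeff (d.erase v) G ≠ 0`**.  Consequence for card A (idea-1's words): with `v`
saturated the Newton constraints of `G` on the other coordinates are those of the slice.  Nothing here is a statement of the manuscript under
review on ladder RESOLUTION; not a verdict on card A.  AI proof, weaker than expert review.
-/

set_option linter.dupNamespace false -- mandated namespace of this single-conjunct summit
set_option autoImplicit false

namespace Summit.ResolutionOfSingularities.ResolutionOfSingularities.Theorems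

namespace GradedGame

open MvPowerSeries
open Literature.AlgebraicGeometry.Resolution

variable {k : Type} [Field k]

section Support

variable {n : ℕ} (w : Fin (n + 1) → ℕ) (c : Fin (n + 1) → k) (q : ℕ)

/-- res-type-060's scaling `Tw_q` restricted to the slice variables is the diagonal scaling `scaleFam ρ`, `ρ = (1, resExp w q ∘ castSucc)`.
[OURS · L1 W4.3] -/
theorem wildTw_castSucc (i : Fin (n + 1)) :
    wildTw (k := k) w q (Fin.castSucc i) = scaleFam (k := k) (Fin.cases 1 fun j => resExp w q (Fin.castSucc j) : Fin (n + 1) → ℕ) i := by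
  unfold scaleFam
  refine Fin.cases ?_ (fun j => ?_) i
  · rw [Fin.castSucc_zero, wildTw_zero]; simp
  · rw [← Fin.succ_castSucc, wildTw_succ]; simp

/-- **THE WILD TRIVIALIZATION IN DIAGONAL FORM**: `(g ∘ Λ_q)(…, y_v^q) = (1+y_v)ᵃ · (g|_{y_v=0})((1+y_v)^ρ x)`. [OURS · L1 W4.3] -/
theorem subst_frobFamily_wildLambda_eq_scaleFam (hq : 0 < q)
    (hfrob : ((1 : MvPowerSeries (Fin (n + 1 + 1)) k) + X (Fin.last (n + 1))) ^ q = 1 + X (Fin.last (n + 1)) ^ q)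
    (hw : 0 < w (Fin.last n)) (hv : q ∣ w (Fin.last n)) (hmin : ∀ j, j ≠ Fin.last n → c j ≠ 0 → q ∣ w j)
    (F' : MvPowerSeries (Fin (n + 1)) k) (a : ℕ) (g : MvPowerSeries (Fin (n + 1 + 1)) k)
    (hfac : subst (CobordantGame.cruxChart k w c) F' = X 0 ^ a * g) :
    subst (frobFamily (k := k) n q) (subst (wildLambda w c q) g) =
      (1 + X (Fin.last (n + 1))) ^ a *
        subst (scaleFam (k := k) (Fin.cases 1 fun j => resExp w q (Fin.castSucc j) : Fin (n + 1) → ℕ)) (sliceGerm (Fin.last n) g) := by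
  rw [← subst_wildLambdaFrob w c q hq, subst_wildLambdaFrob_eq w c q hq hfrob hw hv hmin F' a g hfac, subst_cylinder (hasSubst_wildTw w q)]
  congr 2
  funext i
  exact wildTw_castSucc w q i

/-- **SUPPORT OF A WILD SUCCESSOR** (idea-1 Sketch v5 `Round5.stub_support_wildSuccessor`, same signature): in the renormalised frame `Λ_q`,
every monomial of `G = g ∘ Λ_q` projects, `y_v ↦ 1`, onto a monomial of `G` on the slice `{y_v = 0}` — i.e. if `[d] G ≠ 0` then
`[d.erase v] G ≠ 0`.  (Both coefficients are read on the Frobenius cover, where `G` is `(1+y_v)ᵃ · h((1+y_v)^ρ x)`: the `x`-part of `d` lies in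
the support of the slice `h`, and the coefficient of `x^e·y_v^0` there is `h_e` itself.) [OURS · L1 W4.3] -/
theorem support_wildSuccessor (hq : 0 < q)
    (hfrob : ((1 : MvPowerSeries (Fin (n + 1 + 1)) k) + X (Fin.last (n + 1))) ^ q = 1 + X (Fin.last (n + 1)) ^ q)
    (hw : 0 < w (Fin.last n)) (hv : q ∣ w (Fin.last n)) (hmin : ∀ j, j ≠ Fin.last n → c j ≠ 0 → q ∣ w j)
    (F' : MvPowerSeries (Fin (n + 1)) k) (a : ℕ) (g : MvPowerSeries (Fin (n + 1 + 1)) k)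
    (hfac : subst (CobordantGame.cruxChart k w c) F' = X 0 ^ a * g)
    (d : Fin (n + 1 + 1) →₀ ℕ) (hd : coeff d (subst (wildLambda w c q) g) ≠ 0) :
    coeff (d.erase (Fin.last (n + 1))) (subst (wildLambda w c q) g) ≠ 0 := by
  classical
  set G := subst (wildLambda w c q) g with hG
  set ρ : Fin (n + 1) → ℕ := Fin.cases 1 fun j => resExp w q (Fin.castSucc j) with hρ
  set h := sliceGerm (Fin.last n) g with hh
  have hcov := subst_frobFamily_wildLambda_eq_scaleFam w c q hq hfrob hw hv hmin F' a g hfac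
  have hpure := isPureLast_one_add_X_pow (k := k) (m := n + 1) a
  -- the `x`-part of `d`
  set e : Fin (n + 1) →₀ ℕ := Finsupp.equivFunOnFinite.symm fun j => d (Fin.castSucc j) with he
  -- `[d] G = [x^e y_v^{q d_v}] G(…, y_v^q)`
  have hdec : linExp (frobExp (n + 1) q) d = linExp (cylExp (n + 1)) e + Finsupp.single (Fin.last (n + 1)) (d (Fin.last (n + 1)) * q) := by
    ext x
    refine Fin.lastCases ?_ (fun l => ?_) x
    · rw [linExp_frobExp_last, Finsupp.add_apply, linExp_cylExp_last, Finsupp.single_eq_same, zero_add]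
    · rw [linExp_frobExp_castSucc, Finsupp.add_apply, linExp_cylExp_castSucc, Finsupp.single_apply,
        if_neg (Fin.castSucc_lt_last l).ne', add_zero]
      simp [he]
  have h1 : coeff d G = coeff e h * coeff (Finsupp.single (Fin.last (n + 1)) (d (Fin.last (n + 1)) * q))
      (((1 : MvPowerSeries (Fin (n + 1 + 1)) k) + X (Fin.last (n + 1))) ^ a * (1 + X (Fin.last (n + 1))) ^ (tauDeg ρ e)) := by
    rw [← coeff_linExp_subst_frobFamily n q hq G d, hcov, hdec, coeff_pureLast_mul_subst_scaleFam ρ hpure]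
  have he0 : coeff e h ≠ 0 := by
    intro h0; apply hd; rw [h1, h0, zero_mul]
  -- `[d.erase v] G = [x^e y_v^0] G(…, y_v^q) = h_e`
  have hdec' : linExp (frobExp (n + 1) q) (d.erase (Fin.last (n + 1))) = linExp (cylExp (n + 1)) e + Finsupp.single (Fin.last (n + 1)) 0 := by
    ext x
    refine Fin.lastCases ?_ (fun l => ?_) x
    · rw [linExp_frobExp_last, Finsupp.erase_same, zero_mul, Finsupp.add_apply, linExp_cylExp_last, Finsupp.single_eq_same, add_zero]
    · rw [linExp_frobExp_castSucc, Finsupp.erase_ne (Fin.castSucc_lt_last l).ne, Finsupp.add_apply, linExp_cylExp_castSucc,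
        Finsupp.single_apply, if_neg (Fin.castSucc_lt_last l).ne', add_zero]
      simp [he]
  rw [← coeff_linExp_subst_frobFamily n q hq G, hcov, hdec', coeff_pureLast_mul_subst_scaleFam ρ hpure, Finsupp.single_zero,
    coeff_zero_eq_constantCoeff_apply, map_mul, map_pow, constantCoeff_one_add_X_pow]
  simpa [constantCoeff_X] using he0

end Support

end GradedGame

end Summit.ResolutionOfSingularities.ResolutionOfSingularities.Theorems
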